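import Summits.CriticalPhenomena.PercolationContinuityZ3.Theorems.PercNearOneGluingNoHeavyLowerTailKNGoodGCThreeHairMove
import Summits.CriticalPhenomena.PercolationContinuityZ3.Theorems.PercNearOneGluingNoHeavyLowerTailKNGoodGCThreeKillTwin
import HarnessLib

/-!
# Absorbing ANY NUMBER of sure pendant twins into the observer (`NoHeavyLowerTail` cell, stmt-CriticalPhenomena-4575;
# prover `prim-hp-2`, gen 14) — tool file for "GC₃ with `m` stars" (memo MEMO-gen14 §7)

Support file (`--supports stmt-CriticalPhenomena-4575`).  No definitions, no named facts, no sorries.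

`KNGoodGC3.mergedStar_exists` (gen 12) merges ONE pendant star `y`, glued to the observer `x` by a sure pair, into `x` (three hair moves
`agood_moveHair_twin`, then `agood_kill_pendantTwin`) without changing the goodness functional `agood(·, x; j)`.  Here:

* `KNGoodGC3Multi.absorbTwin_exists` — the same step for an observer `x` that may carry OTHER pairs (further twins): from `u s(x,y) = 1` and `y`
  pendant (pairs only to `x` and the three ports) one gets `N` with `agood(u, x; j) = agood(N, x; j)`, hairs at `x` merged
  (`x_i + y_i − x_i y_i`), every non-loop pair at `y` killed, every pair avoiding `x, y` and every other pair at `x` unchanged.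
* `KNGoodGC3Multi.absorbTwins_exists` — iterated over a LIST of sure pendant twins `ys` of the observer `o`: `agood(u, o; j) = agood(N, o; j)`
  with `N s(o,a_i) = 1 − (1 − u s(o,a_i))·∏_{y ∈ ys}(1 − u s(y,a_i))`, the twins killed, everything else at and away from `o` unchanged.
Use: the star-forced graph of an observer with several pendant-star children is such a `u`; after absorption the observer is ONE-LAYER with the
merged hairs, and `KNGoodTwoTwo.agood_oneLayer_ge` / `KNGoodGC3.agood_threePort_ge` expand its goodness functional (memo §7(3)).
[cite: KozmaNitzan2024, §3.2 Definition (p. 12), proof of Thm. 5 (pp. 13–14); folklore]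
-/

noncomputable section

namespace Summit.CriticalPhenomena.PercolationContinuityZ3.Theorems

open MeasureTheory Set Literature.Probability.LatticeModels Literature.Probability.Percolation
open scoped Classical BigOperators

variable {n : ℕ}

namespace KNGoodGC3Multi

open ChampionStability KNGoodAux KNGoodHair KNGoodSeries KNGoodPortFree KNGoodGC3

/-- **Absorbing one sure pendant twin.**  `u s(x,y) = 1`, `y` has no other positive pair except to the ports `a₁,a₂,a₃`; then there is `N` with
`agood(u, x; j) = agood(N, x; j)`, merged hairs at `x`, `y` killed (non-loop pairs), all pairs avoiding `{x,y}` and all other pairs at `x`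
unchanged. [cite: KozmaNitzan2024, §3.2 Definition (p. 12), proof of Thm. 5 (pp. 13–14); folklore] -/
theorem absorbTwin_exists (u : Sym2 (Fin n) → unitInterval) (A : Finset (Fin n)) (hA : A.Nonempty)
    (x y b a₁ a₂ a₃ j : Fin n) (hxy : x ≠ y) (hxa₁ : x ≠ a₁) (hxa₂ : x ≠ a₂) (hxa₃ : x ≠ a₃)
    (hya₁ : y ≠ a₁) (hya₂ : y ≠ a₂) (hya₃ : y ≠ a₃) (h12 : a₁ ≠ a₂) (h13 : a₁ ≠ a₃) (h23 : a₂ ≠ a₃)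
    (hyA : y ∉ A) (hjA : j ∈ A) (hby : b ≠ y) (hsure : u s(x, y) = 1)
    (hyN : ∀ z : Fin n, z ≠ a₁ → z ≠ a₂ → z ≠ a₃ → z ≠ x → u s(y, z) = 0) :
    ∃ N : Sym2 (Fin n) → unitInterval,
      ((prodBernoulli u).real (openConn x b) - (prodBernoulli u).real (openConn j b) +
          ∑ W ∈ nullSets A, (prodBernoulli u).real (clusterIs x W) *
            A.inf' hA (fun a' => (prodBernoulli u).real (openConnIn ((↑W : Set (Fin n))ᶜ) a' b)) =
        (prodBernoulli N).real (openConn x b) - (prodBernoulli N).real (openConn j b) +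
          ∑ W ∈ nullSets A, (prodBernoulli N).real (clusterIs x W) *
            A.inf' hA (fun a' => (prodBernoulli N).real (openConnIn ((↑W : Set (Fin n))ᶜ) a' b))) ∧
      ((N s(x, a₁) : ℝ) = u s(x, a₁) + u s(y, a₁) - u s(x, a₁) * u s(y, a₁)) ∧
      ((N s(x, a₂) : ℝ) = u s(x, a₂) + u s(y, a₂) - u s(x, a₂) * u s(y, a₂)) ∧
      ((N s(x, a₃) : ℝ) = u s(x, a₃) + u s(y, a₃) - u s(x, a₃) * u s(y, a₃)) ∧
      (∀ e : Sym2 (Fin n), x ∉ e → y ∉ e → N e = u e) ∧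
      (∀ z : Fin n, z ≠ a₁ → z ≠ a₂ → z ≠ a₃ → z ≠ y → N s(x, z) = u s(x, z)) ∧
      (∀ z : Fin n, z ≠ y → N s(y, z) = 0) := by
  -- pair bookkeeping
  have kxy : ∀ c d : Fin n, x ≠ d → s(x, c) ≠ s(y, d) := by
    intro c d hxd h
    rcases Sym2.eq_iff.1 h with ⟨h1, _⟩ | ⟨h1, _⟩
    · exact hxy h1
    · exact hxd h1
  have kxx : ∀ c d : Fin n, c ≠ d → s(x, c) ≠ s(x, d) := fun c d hcd h => hcd (Sym2.congr_right.1 h)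
  have kyy : ∀ c d : Fin n, c ≠ d → s(y, c) ≠ s(y, d) := fun c d hcd h => hcd (Sym2.congr_right.1 h)
  have kyx : ∀ c d : Fin n, y ≠ d → s(y, c) ≠ s(x, d) := by
    intro c d hyd h
    rcases Sym2.eq_iff.1 h with ⟨h1, _⟩ | ⟨h1, _⟩
    · exact hxy h1.symm
    · exact hyd h1
  -- the chain of weight functions
  set v₁ : Sym2 (Fin n) → unitInterval := Function.update (Function.update u s(y, a₁) 0) s(x, a₁)
    ⟨(u s(x, a₁) : ℝ) + u s(y, a₁) - u s(x, a₁) * u s(y, a₁), mergeHair_mem (u s(x, a₁)) (u s(y, a₁))⟩ with hv₁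
  set v₂ : Sym2 (Fin n) → unitInterval := Function.update (Function.update v₁ s(y, a₂) 0) s(x, a₂)
    ⟨(v₁ s(x, a₂) : ℝ) + v₁ s(y, a₂) - v₁ s(x, a₂) * v₁ s(y, a₂), mergeHair_mem (v₁ s(x, a₂)) (v₁ s(y, a₂))⟩ with hv₂
  set v₃ : Sym2 (Fin n) → unitInterval := Function.update (Function.update v₂ s(y, a₃) 0) s(x, a₃)
    ⟨(v₂ s(x, a₃) : ℝ) + v₂ s(y, a₃) - v₂ s(x, a₃) * v₂ s(y, a₃), mergeHair_mem (v₂ s(x, a₃)) (v₂ s(y, a₃))⟩ with hv₃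
  set F : Set (Sym2 (Fin n)) := {e : Sym2 (Fin n) | y ∈ e ∧ ¬ e.IsDiag} with hF
  set N : Sym2 (Fin n) → unitInterval := pinW v₃ F ∅ with hN
  -- generic evaluation off the updated keys
  have ev₁ : ∀ e : Sym2 (Fin n), e ≠ s(y, a₁) → e ≠ s(x, a₁) → v₁ e = u e := by
    intro e h1 h2; rw [hv₁, Function.update_of_ne h2, Function.update_of_ne h1]
  have ev₂ : ∀ e : Sym2 (Fin n), e ≠ s(y, a₂) → e ≠ s(x, a₂) → v₂ e = v₁ e := by
    intro e h1 h2; rw [hv₂, Function.update_of_ne h2, Function.update_of_ne h1]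
  have ev₃ : ∀ e : Sym2 (Fin n), e ≠ s(y, a₃) → e ≠ s(x, a₃) → v₃ e = v₂ e := by
    intro e h1 h2; rw [hv₃, Function.update_of_ne h2, Function.update_of_ne h1]
  have evN : ∀ e : Sym2 (Fin n), y ∉ e → N e = v₃ e := by
    intro e hy; rw [hN]; exact pinW_apply_of_not_mem v₃ ∅ (fun h => hy h.1)
  -- values along the chain
  have w1x2 : v₁ s(x, a₂) = u s(x, a₂) := ev₁ _ (kxy a₂ a₁ hxa₁) (kxx a₂ a₁ h12.symm)
  have w1y2 : v₁ s(y, a₂) = u s(y, a₂) := ev₁ _ (kyy a₂ a₁ h12.symm) (kyx a₂ a₁ hya₁)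
  have w1x3 : v₁ s(x, a₃) = u s(x, a₃) := ev₁ _ (kxy a₃ a₁ hxa₁) (kxx a₃ a₁ h13.symm)
  have w1y3 : v₁ s(y, a₃) = u s(y, a₃) := ev₁ _ (kyy a₃ a₁ h13.symm) (kyx a₃ a₁ hya₁)
  have w2x3 : v₂ s(x, a₃) = u s(x, a₃) := by rw [ev₂ _ (kxy a₃ a₂ hxa₂) (kxx a₃ a₂ h23.symm), w1x3]
  have w2y3 : v₂ s(y, a₃) = u s(y, a₃) := by rw [ev₂ _ (kyy a₃ a₂ h23.symm) (kyx a₃ a₂ hya₂), w1y3]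
  -- the three merged hairs
  have m1 : ((v₁ s(x, a₁) : unitInterval) : ℝ) = u s(x, a₁) + u s(y, a₁) - u s(x, a₁) * u s(y, a₁) := by
    rw [hv₁, Function.update_self]
  have m2 : ((v₂ s(x, a₂) : unitInterval) : ℝ) = u s(x, a₂) + u s(y, a₂) - u s(x, a₂) * u s(y, a₂) := by
    rw [hv₂, Function.update_self]; simp only
    rw [w1x2, w1y2]
  have m3 : ((v₃ s(x, a₃) : unitInterval) : ℝ) = u s(x, a₃) + u s(y, a₃) - u s(x, a₃) * u s(y, a₃) := by
    rw [hv₃, Function.update_self]; simp only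
    rw [w2x3, w2y3]
  have nyx : ∀ c : Fin n, c ≠ y → y ∉ s(x, c) := by
    intro c hc h; rcases Sym2.mem_iff.1 h with h | h
    · exact hxy h.symm
    · exact hc h.symm
  have hN1 : ((N s(x, a₁) : unitInterval) : ℝ) = u s(x, a₁) + u s(y, a₁) - u s(x, a₁) * u s(y, a₁) := by
    rw [evN _ (nyx a₁ hya₁.symm), ev₃ _ (kxy a₁ a₃ hxa₃) (kxx a₁ a₃ h13), ev₂ _ (kxy a₁ a₂ hxa₂) (kxx a₁ a₂ h12), m1]
  have hN2 : ((N s(x, a₂) : unitInterval) : ℝ) = u s(x, a₂) + u s(y, a₂) - u s(x, a₂) * u s(y, a₂) := by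
    rw [evN _ (nyx a₂ hya₂.symm), ev₃ _ (kxy a₂ a₃ hxa₃) (kxx a₂ a₃ h23), m2]
  have hN3 : ((N s(x, a₃) : unitInterval) : ℝ) = u s(x, a₃) + u s(y, a₃) - u s(x, a₃) * u s(y, a₃) := by
    rw [evN _ (nyx a₃ hya₃.symm), m3]
  -- pairs away from the keys keep their `u`-value
  have away : ∀ e : Sym2 (Fin n), x ∉ e → y ∉ e → v₃ e = u e := by
    intro e hx hy
    have k1 : ∀ c : Fin n, e ≠ s(x, c) := fun c h => hx (h ▸ Sym2.mem_mk_left x c)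
    have k2 : ∀ c : Fin n, e ≠ s(y, c) := fun c h => hy (h ▸ Sym2.mem_mk_left y c)
    rw [ev₃ e (k2 a₃) (k1 a₃), ev₂ e (k2 a₂) (k1 a₂), ev₁ e (k2 a₁) (k1 a₁)]
  -- the goodness chain
  have hs1 : v₁ s(x, y) = 1 := by rw [ev₁ _ (kxy y a₁ hxa₁) (kxx y a₁ hya₁), hsure]
  have hs2 : v₂ s(x, y) = 1 := by rw [ev₂ _ (kxy y a₂ hxa₂) (kxx y a₂ hya₂), hs1]
  have hs3 : v₃ s(x, y) = 1 := by rw [ev₃ _ (kxy y a₃ hxa₃) (kxx y a₃ hya₃), hs2]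
  have e1 := agood_moveHair_twin u A hA x y a₁ j b hxy hxa₁ hya₁ hsure
  have e2 := agood_moveHair_twin v₁ A hA x y a₂ j b hxy hxa₂ hya₂ hs1
  have e3 := agood_moveHair_twin v₂ A hA x y a₃ j b hxy hxa₃ hya₃ hs2
  have hiso : ∀ z : Fin n, z ≠ y → z ≠ x → v₃ s(y, z) = 0 := by
    intro z hzy hzx
    by_cases h3 : z = a₃
    · subst h3; rw [hv₃, Function.update_of_ne (kyx z z hzy.symm), Function.update_self]
    rw [ev₃ _ (kyy z a₃ h3) (kyx z a₃ hya₃)]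
    by_cases h2 : z = a₂
    · subst h2; rw [hv₂, Function.update_of_ne (kyx z z hzy.symm), Function.update_self]
    rw [ev₂ _ (kyy z a₂ h2) (kyx z a₂ hya₂)]
    by_cases h1 : z = a₁
    · subst h1; rw [hv₁, Function.update_of_ne (kyx z z hzy.symm), Function.update_self]
    rw [ev₁ _ (kyy z a₁ h1) (kyx z a₁ hya₁)]
    exact hyN z h1 h2 h3 hzx
  have e4 := agood_kill_pendantTwin v₃ A hA j b hxy hyA hjA hby hs3 hiso
  refine ⟨N, ?_, hN1, hN2, hN3, ?_, ?_, ?_⟩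
  · rw [e1, e2, e3, e4]
  · intro e hx hy
    rw [evN e hy, away e hx hy]
  · intro z hz1 hz2 hz3 hzy
    rw [evN _ (nyx z hzy), ev₃ _ (kxy z a₃ hxa₃) (kxx z a₃ hz3), ev₂ _ (kxy z a₂ hxa₂) (kxx z a₂ hz2),
      ev₁ _ (kxy z a₁ hxa₁) (kxx z a₁ hz1)]
  · intro z hzy
    rw [hN]
    exact pinW_apply_of_mem_of_not_mem v₃ ⟨Sym2.mem_mk_left y z, by rw [Sym2.mk_isDiag_iff]; exact fun h => hzy h.symm⟩
      (Set.notMem_empty _)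

/-- **Absorbing a list of sure pendant twins.**  `ys` duplicate-free; every `y ∈ ys` is glued to the observer `o` by a sure pair and has no
other positive pair except to the ports `a₁,a₂,a₃`.  Then `agood(u, o; j) = agood(N, o; j)` for an `N` with the product-merged hairs
`N s(o,a_i) = 1 − (1 − u s(o,a_i))·∏_{y∈ys}(1 − u s(y,a_i))`, the twins killed, all other pairs at `o` and away from `o, ys` unchanged.
[cite: KozmaNitzan2024, §3.2 Definition (p. 12), proof of Thm. 5 (pp. 13–14); folklore] -/
theorem absorbTwins_exists (A : Finset (Fin n)) (hA : A.Nonempty) (o b a₁ a₂ a₃ j : Fin n)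
    (hoa₁ : o ≠ a₁) (hoa₂ : o ≠ a₂) (hoa₃ : o ≠ a₃) (h12 : a₁ ≠ a₂) (h13 : a₁ ≠ a₃) (h23 : a₂ ≠ a₃) (hjA : j ∈ A)
    (ys : List (Fin n)) (hnd : ys.Nodup)
    (hys : ∀ y ∈ ys, y ≠ o ∧ y ≠ a₁ ∧ y ≠ a₂ ∧ y ≠ a₃ ∧ y ∉ A ∧ b ≠ y)
    (u : Sym2 (Fin n) → unitInterval) (hsure : ∀ y ∈ ys, u s(o, y) = 1)
    (hyN : ∀ y ∈ ys, ∀ z : Fin n, z ≠ a₁ → z ≠ a₂ → z ≠ a₃ → z ≠ o → u s(y, z) = 0) :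
    ∃ N : Sym2 (Fin n) → unitInterval,
      ((prodBernoulli u).real (openConn o b) - (prodBernoulli u).real (openConn j b) +
          ∑ W ∈ nullSets A, (prodBernoulli u).real (clusterIs o W) *
            A.inf' hA (fun a' => (prodBernoulli u).real (openConnIn ((↑W : Set (Fin n))ᶜ) a' b)) =
        (prodBernoulli N).real (openConn o b) - (prodBernoulli N).real (openConn j b) +
          ∑ W ∈ nullSets A, (prodBernoulli N).real (clusterIs o W) *
            A.inf' hA (fun a' => (prodBernoulli N).real (openConnIn ((↑W : Set (Fin n))ᶜ) a' b))) ∧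
      ((N s(o, a₁) : ℝ) = 1 - (1 - (u s(o, a₁) : ℝ)) * (ys.map (fun y => 1 - (u s(y, a₁) : ℝ))).prod) ∧
      ((N s(o, a₂) : ℝ) = 1 - (1 - (u s(o, a₂) : ℝ)) * (ys.map (fun y => 1 - (u s(y, a₂) : ℝ))).prod) ∧
      ((N s(o, a₃) : ℝ) = 1 - (1 - (u s(o, a₃) : ℝ)) * (ys.map (fun y => 1 - (u s(y, a₃) : ℝ))).prod) ∧
      (∀ e : Sym2 (Fin n), o ∉ e → (∀ y ∈ ys, y ∉ e) → N e = u e) ∧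
      (∀ z : Fin n, z ≠ a₁ → z ≠ a₂ → z ≠ a₃ → z ∉ ys → N s(o, z) = u s(o, z)) ∧
      (∀ y ∈ ys, ∀ z : Fin n, z ≠ y → N s(y, z) = 0) := by
  induction ys generalizing u with
  | nil =>
    refine ⟨u, rfl, ?_, ?_, ?_, fun e _ _ => rfl, fun z _ _ _ _ => rfl, fun y hy => ?_⟩
    · simp
    · simp
    · simp
    · simp at hy
  | cons y ys ih =>
    obtain ⟨hyo, hya₁, hya₂, hya₃, hyA, hby⟩ := hys y (List.mem_cons_self)
    have hys' : ∀ y' ∈ ys, y' ≠ o ∧ y' ≠ a₁ ∧ y' ≠ a₂ ∧ y' ≠ a₃ ∧ y' ∉ A ∧ b ≠ y' :=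
      fun y' hy' => hys y' (List.mem_cons_of_mem y hy')
    have hnd' : ys.Nodup := (List.nodup_cons.1 hnd).2
    have hyys : y ∉ ys := (List.nodup_cons.1 hnd).1
    -- absorb the first twin
    obtain ⟨N₁, hag₁, m₁, m₂, m₃, hoff₁, hato₁, hkill₁⟩ :=
      absorbTwin_exists u A hA o y b a₁ a₂ a₃ j (fun h => hyo h.symm) hoa₁ hoa₂ hoa₃ hya₁ hya₂ hya₃ h12 h13 h23 hyA hjA hby
        (hsure y (List.mem_cons_self)) (fun z h1 h2 h3 hzo => hyN y (List.mem_cons_self) z h1 h2 h3 hzo)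
    -- the remaining twins are still sure pendant twins of `o` in `N₁`
    have hsure' : ∀ y' ∈ ys, N₁ s(o, y') = 1 := by
      intro y' hy'
      obtain ⟨-, h1, h2, h3, -, -⟩ := hys' y' hy'
      rw [hato₁ y' h1 h2 h3 (fun h => hyys (h ▸ hy'))]
      exact hsure y' (List.mem_cons_of_mem y hy')
    have hyN' : ∀ y' ∈ ys, ∀ z : Fin n, z ≠ a₁ → z ≠ a₂ → z ≠ a₃ → z ≠ o → N₁ s(y', z) = 0 := by
      intro y' hy' z h1 h2 h3 hzo
      have hy'y : y' ≠ y := fun h => hyys (h ▸ hy')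
      obtain ⟨hy'o, -, -, -, -, -⟩ := hys' y' hy'
      by_cases hzy : z = y
      · subst hzy; rw [Sym2.eq_swap]; exact hkill₁ y' hy'y
      · rw [hoff₁ _ (fun h => by
            rcases Sym2.mem_iff.1 h with h | h
            · exact hy'o h.symm
            · exact hzo h.symm)
          (fun h => by
            rcases Sym2.mem_iff.1 h with h | h
            · exact hy'y h.symm
            · exact hzy h.symm)]
        exact hyN y' (List.mem_cons_of_mem y hy') z h1 h2 h3 hzo
    obtain ⟨N, hag, n₁, n₂, n₃, hoff, hato, hkill⟩ := ih hnd' hys' N₁ hsure' hyN'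
    -- hairs of the remaining twins are unchanged in `N₁`
    have htw : ∀ y' ∈ ys, ∀ a : Fin n, a ≠ o → a ≠ y → N₁ s(y', a) = u s(y', a) := by
      intro y' hy' a hao hay
      have hy'y : y' ≠ y := fun h => hyys (h ▸ hy')
      obtain ⟨hy'o, -, -, -, -, -⟩ := hys' y' hy'
      exact hoff₁ _ (fun h => by
          rcases Sym2.mem_iff.1 h with h | h
          · exact hy'o h.symm
          · exact hao h.symm)
        (fun h => by
          rcases Sym2.mem_iff.1 h with h | h
          · exact hy'y h.symm
          · exact hay h.symm)
    have hprod : ∀ a : Fin n, a ≠ o → a ≠ y →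
        (ys.map (fun y' => 1 - (N₁ s(y', a) : ℝ))).prod = (ys.map (fun y' => 1 - (u s(y', a) : ℝ))).prod := by
      intro a hao hay
      refine congrArg List.prod (List.map_congr_left fun y' hy' => ?_)
      rw [htw y' hy' a hao hay]
    refine ⟨N, hag₁.trans hag, ?_, ?_, ?_, ?_, ?_, ?_⟩
    · rw [n₁, m₁, hprod a₁ hoa₁.symm hya₁.symm, List.map_cons, List.prod_cons]; ring
    · rw [n₂, m₂, hprod a₂ hoa₂.symm hya₂.symm, List.map_cons, List.prod_cons]; ring
    · rw [n₃, m₃, hprod a₃ hoa₃.symm hya₃.symm, List.map_cons, List.prod_cons]; ring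
    · intro e hoe hye
      rw [hoff e hoe (fun y' hy' => hye y' (List.mem_cons_of_mem y hy')), hoff₁ e hoe (hye y (List.mem_cons_self))]
    · intro z h1 h2 h3 hz
      rw [List.mem_cons, not_or] at hz
      rw [hato z h1 h2 h3 hz.2, hato₁ z h1 h2 h3 hz.1]
    · intro y'' hy'' z hz
      rcases List.mem_cons.1 hy'' with rfl | hy''
      · -- the first twin: killed in `N₁`, untouched afterwards
        by_cases hzo : z = o
        · subst hzo
          rw [Sym2.eq_swap, hato _ (fun h => hya₁ h) (fun h => hya₂ h) (fun h => hya₃ h) hyys, ← Sym2.eq_swap]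
          exact hkill₁ z (fun h => hz h)
        · by_cases hzys : z ∈ ys
          · rw [Sym2.eq_swap]; exact hkill z hzys _ (fun h => hz h.symm)
          · rw [hoff _ (fun h => by
                rcases Sym2.mem_iff.1 h with h | h
                · exact hyo h.symm
                · exact hzo h.symm)
              (fun y' hy' h => by
                rcases Sym2.mem_iff.1 h with h | h
                · exact hyys (h ▸ hy')
                · exact hzys (h ▸ hy'))]
            exact hkill₁ z hz
      · exact hkill y'' hy'' z hz

end KNGoodGC3Multi

end Summit.CriticalPhenomena.PercolationContinuityZ3.Theorems
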